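import Mathlib
import Summits.PneNP.PneNP.Theorems.CnfIdealGenLengthRankDefectRepresentationsQuadrantCapture

/-!
# Crux `RankDefectRepresentations` (stmt-PneNP-18923), line `rank-dehn-ladder`: RATIO WITNESS — kernel certificate of the
# `c₀ = 2 / mc = 9` two-family instance (registered stub `stub_ratioWitness`, lead g16 RESHAPE 15, W15; memo
# `Cruxes/RankDefectRepresentations/Lines/rank-dehn-ladder-g16.md` §3)

The instance is IDENTITY DATA (`D = 1`, the `9 × 9` identity matrix) on a WEAK STAIRCASE: row `i` carries the grid point
`s_i` and column `j` the grid point `t_j` with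
`s = (0,0),(0,0),(0,2),(0,2),(2,2),(2,3),(2,4),(2,3),(2,5)` and `t = (1,1),(1,1),(1,0),(1,0),(0,0),(0,2),(0,2),(0,4),(0,3)`
(first coordinate = first-family label `∈ {0,1,2}`, encoded in binary as a colour `Fin 2 → Bool`; second coordinate =
second-family label `∈ {0,…,5}`, encoded in binary as a colour `Fin 3 → Bool`).  Cell `(i,j)` is VISIBLE iff the first-family
colours of row `i` and column `j` differ AND the second-family colours differ.

* (V) every cell `(i,j)` with `j ≤ i` is visible (a `decide` over `Fin 9 × Fin 9` inside `stub_ratioWitness`);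
* (C) no three pairwise distinct indices are mutually visible (a `decide` over the `9³` triples inside `stub_ratioWitness`);
* (R) for every rectangle `(B, B', s, t)` the rectangle part of the identity matrix is the diagonal indicator of the "caught"
  indices (row on the `(s,t)` side, column on the opposite side), and two caught indices are mutually visible
  (`visible_of_inside`), so by (C) at most `2` indices are caught: `rank ≤ 2` (`rank_rect_one_le_two`);
* (M) every completion `L` of the visible cells of `1` is unit upper-triangular by (V), so `det L = 1` and `rank L = 9`
  (`rank_eq_of_completion`).

HONEST FRAMING: an elementary finite certificate (the ratio instance of the line's memo); P ≠ NP is not moved; F-N2 is a FRONTIER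
formal rung.
-/

set_option linter.dupNamespace false -- `Summit.PneNP.PneNP.…`: summit = sub-problem name (D-0017)

namespace Summit.PneNP.PneNP.Theorems.CnfIdealGenLengthRankDefectRepresentationsRatioWitness

open Matrix Finset
open Summit.PneNP.PneNP.Theorems.CnfIdealGenLengthRankDefectRepresentationsTwoFamilyCutDomination (colourI colourJ)
open Summit.PneNP.PneNP.Theorems.CnfIdealGenLengthRankDefectRepresentationsQuadrantCapture (rect rect_apply)

/-! ## Generic lemmas (any colouring of `Fin 9` rows and columns) -/

section Generic

variable {K : Type} [Field K]

/-- A cell inside a rectangle is visible: the row lies on side `s` of `B` and the column on side `!s` (likewise for `B'`), so the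
colours differ in both families.  (Stated for arbitrary colourings.) -/
theorem visible_of_inside {n n' : ℕ} {ι ι' : Type} (row : ι → Fin n ⊕ Fin n' → Bool) (col : ι' → Fin n ⊕ Fin n' → Bool)
    (B : Finset (Fin n → Bool)) (B' : Finset (Fin n' → Bool)) (s t : Bool) (x : ι) (y : ι')
    (hx : decide (colourI (row x) ∈ B) = s ∧ decide (colourJ (row x) ∈ B') = t)
    (hy : decide (colourI (col y) ∈ B) = !s ∧ decide (colourJ (col y) ∈ B') = !t) :
    colourI (row x) ≠ colourI (col y) ∧ colourJ (row x) ≠ colourJ (col y) := by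
  refine ⟨fun h => ?_, fun h => ?_⟩
  · have h1 := hx.1
    rw [h, hy.1] at h1
    cases s <;> simp at h1
  · have h2 := hx.2
    rw [h, hy.2] at h2
    cases t <;> simp at h2

/-- (R) If no three pairwise distinct indices are MUTUALLY VISIBLE (cells `(a,b)` and `(b,a)` both visible for each pair), then
every rectangle part of the identity matrix has rank `≤ 2`: it is the diagonal indicator of the "caught" indices (row on the
`(s,t)` side, column on the opposite side), and caught indices are mutually visible (`visible_of_inside`). -/
theorem rank_rect_one_le_two (row col : Fin 9 → Fin 2 ⊕ Fin 3 → Bool)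
    (hC : ∀ a b c : Fin 9, a ≠ b → a ≠ c → b ≠ c →
      ¬ ((colourI (row a) ≠ colourI (col b) ∧ colourJ (row a) ≠ colourJ (col b)) ∧
          (colourI (row b) ≠ colourI (col a) ∧ colourJ (row b) ≠ colourJ (col a)) ∧
          (colourI (row a) ≠ colourI (col c) ∧ colourJ (row a) ≠ colourJ (col c)) ∧
          (colourI (row c) ≠ colourI (col a) ∧ colourJ (row c) ≠ colourJ (col a)) ∧
          (colourI (row b) ≠ colourI (col c) ∧ colourJ (row b) ≠ colourJ (col c)) ∧
          (colourI (row c) ≠ colourI (col b) ∧ colourJ (row c) ≠ colourJ (col b))))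
    (B : Finset (Fin 2 → Bool)) (B' : Finset (Fin 3 → Bool)) (s t : Bool) :
    (rect row col B B' s t (1 : Matrix (Fin 9) (Fin 9) K)).rank ≤ 2 := by
  classical
  -- the caught indices
  set P : Fin 9 → Prop := fun i =>
    (decide (colourI (row i) ∈ B) = s ∧ decide (colourJ (row i) ∈ B') = t) ∧
      (decide (colourI (col i) ∈ B) = !s ∧ decide (colourJ (col i) ∈ B') = !t)
  have hM : rect row col B B' s t (1 : Matrix (Fin 9) (Fin 9) K) = Matrix.diagonal (fun i => if P i then (1 : K) else 0) := by
    ext i j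
    rw [rect_apply, Matrix.diagonal_apply]
    by_cases hij : i = j
    · subst hij
      rw [Matrix.one_apply_eq, if_pos rfl]
    · rw [Matrix.one_apply_ne hij, if_neg hij, ite_self]
  rw [hM, Matrix.rank_diagonal]
  have e : Fintype.card {i // (if P i then (1 : K) else 0) ≠ 0} = Fintype.card {i // P i} :=
    Fintype.card_congr (Equiv.subtypeEquivRight fun i => by simp)
  rw [e, Fintype.card_subtype]
  by_contra hlt
  rw [not_le, Finset.two_lt_card_iff] at hlt
  obtain ⟨a, b, c, ha, hb, hc, hab, hac, hbc⟩ := hlt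
  simp only [Finset.mem_filter, Finset.mem_univ, true_and] at ha hb hc
  exact hC a b c hab hac hbc
    ⟨visible_of_inside row col B B' s t a b ha.1 hb.2, visible_of_inside row col B B' s t b a hb.1 ha.2,
      visible_of_inside row col B B' s t a c ha.1 hc.2, visible_of_inside row col B B' s t c a hc.1 ha.2,
      visible_of_inside row col B B' s t b c hb.1 hc.2, visible_of_inside row col B B' s t c b hc.1 hb.2⟩

/-- (M) If every cell on or below the diagonal is visible, every matrix agreeing with the identity on the visible cells is unit
upper-triangular, hence has rank `9`. -/
theorem rank_eq_of_completion (row col : Fin 9 → Fin 2 ⊕ Fin 3 → Bool)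
    (hV : ∀ i j : Fin 9, j ≤ i → colourI (row i) ≠ colourI (col j) ∧ colourJ (row i) ≠ colourJ (col j))
    (L : Matrix (Fin 9) (Fin 9) K)
    (hL : ∀ i j, colourI (row i) ≠ colourI (col j) → colourJ (row i) ≠ colourJ (col j) →
      L i j = (1 : Matrix (Fin 9) (Fin 9) K) i j) :
    L.rank = 9 := by
  classical
  have hdet : L.det = 1 := by
    have htri : L.BlockTriangular id := by
      intro i j hij
      have hij' : j < i := hij
      have hv := hV i j hij'.le
      rw [hL i j hv.1 hv.2]
      exact Matrix.one_apply_ne' hij'.ne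
    rw [Matrix.det_of_upperTriangular htri]
    refine Finset.prod_eq_one fun i _ => ?_
    have hv := hV i i le_rfl
    rw [hL i i hv.1 hv.2, Matrix.one_apply_eq]
  have hU : IsUnit L := (Matrix.isUnit_iff_isUnit_det L).mpr (hdet ▸ isUnit_one)
  rw [Matrix.rank_of_isUnit L hU, Fintype.card_fin]

end Generic

/-! ## The registered stub -/

/-- **RATIO WITNESS** (registered stub `stub_ratioWitness` of `Cruxes/RankDefectRepresentations/Lines/rank_dehn_ladder.lean`, lead g16
RESHAPE 15, W15): an explicit two-family instance on `9` rows and `9` columns (colours in `{0,1}^2 × {0,1}^3`) such that every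
rectangle part of the identity matrix has rank `≤ 2` over every field, while every completion of the visible cells of the identity
matrix has rank `9`.  Witness: `row`, `col` (the weak staircase of memo g16 §3). -/
theorem stub_ratioWitness :
    ∃ (row col : Fin 9 → Fin 2 ⊕ Fin 3 → Bool),
      (∀ (K : Type) [Field K] (B : Finset (Fin 2 → Bool)) (B' : Finset (Fin 3 → Bool)) (s t : Bool),
        (Summit.PneNP.PneNP.Theorems.CnfIdealGenLengthRankDefectRepresentationsQuadrantCapture.rect row col B B' s t
          (1 : Matrix (Fin 9) (Fin 9) K)).rank ≤ 2) ∧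
      (∀ (K : Type) [Field K] (L : Matrix (Fin 9) (Fin 9) K),
        (∀ i j, Summit.PneNP.PneNP.Theorems.CnfIdealGenLengthRankDefectRepresentationsTwoFamilyCutDomination.colourI (row i) ≠
            Summit.PneNP.PneNP.Theorems.CnfIdealGenLengthRankDefectRepresentationsTwoFamilyCutDomination.colourI (col j) →
          Summit.PneNP.PneNP.Theorems.CnfIdealGenLengthRankDefectRepresentationsTwoFamilyCutDomination.colourJ (row i) ≠
            Summit.PneNP.PneNP.Theorems.CnfIdealGenLengthRankDefectRepresentationsTwoFamilyCutDomination.colourJ (col j) →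
          L i j = (1 : Matrix (Fin 9) (Fin 9) K) i j) →
        L.rank = 9) := by
  -- the witness: binary codes of the staircase labels `s_i = (sP i, sQ i)` (rows) and `t_j = (tP j, tQ j)` (columns)
  refine ⟨fun i => Sum.elim (fun k : Fin 2 => ((![0, 0, 0, 0, 2, 2, 2, 2, 2] : Fin 9 → ℕ) i).testBit k.val)
        (fun k : Fin 3 => ((![0, 0, 2, 2, 2, 3, 4, 3, 5] : Fin 9 → ℕ) i).testBit k.val),
      fun j => Sum.elim (fun k : Fin 2 => ((![1, 1, 1, 1, 0, 0, 0, 0, 0] : Fin 9 → ℕ) j).testBit k.val)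
        (fun k : Fin 3 => ((![1, 1, 0, 0, 0, 2, 2, 4, 3] : Fin 9 → ℕ) j).testBit k.val),
      fun K _ B B' s t => rank_rect_one_le_two _ _ ?_ B B' s t,
      fun K _ L hL => rank_eq_of_completion _ _ ?_ L hL⟩
  · -- (C) no three pairwise distinct indices are mutually visible: a finite check over `Fin 9 × Fin 9 × Fin 9`
    decide
  · -- (V) every cell on or below the diagonal is visible: a finite check over `Fin 9 × Fin 9`
    decide

end Summit.PneNP.PneNP.Theorems.CnfIdealGenLengthRankDefectRepresentationsRatioWitness
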